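import Summits.NavierStokesRegularity.NavierStokesRegularity.Theorems.SqueezeCycleSingularZoomSingular
import Summits.NavierStokesRegularity.NavierStokesRegularity.Theorems.SqueezeCycleExtremalElementExistsRescale
import HarnessLib

/-!
# Crux `ClockStretchingLaw.ClockLaw` (stmt-NavierStokesRegularity-10571), line `birth`, stub 7
# `stub_limitSingular`: limits of zooms of a singular element are singular

Theorem file (theorems only) for the registered stub `stub_limitSingular : ClassPressure →
LimitSingular` of the skeleton `Cruxes/ClockLaw/Lines/birth.lean`.

Let `u` be a Type-I KNSS-mild ancient field (`IsTypeIAncientMild C u`) with the energy ledger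
`A, E ≤ C` on every backward parabolic cylinder with vertex time `≤ 0`, singular at the space-time
origin (unbounded on every `Q(0, r)`), and let its parabolic zooms
`u_{c_j} = c_j • stPull (c_j²) c_j 0 0 u`, `u_{c_j}(s, y) = c_j u(c_j² s, c_j y)`, along positive
scales `c_j` converge pointwise on the open lower slab `t < 0` to a field `W`. GIVEN the class
pressure with a uniform bound (the conclusion of stub 6: every element of the class is, with some
pressure, a suitable weak solution in the unit parabolic ball with `‖u‖_{L³(Q₁)}, ‖p‖_{L^{3/2}(Q₁)}
≤ K(C)`), the limit `W` is singular at the origin.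

Proof: feed the tree's **persistence of singularities in the limit**
`unbounded_at_origin_of_zoomIn_limit` (Rusin–Šverák 2011; Albritton–Barker 2019, Lemma 2.2 and
Prop. 2.3, `SqueezeCycleSingularZoomSingular.lean`) with the zooms:

* each zoom is in the class with the SAME constant and the SAME ledger (`isTypeIAncientMild_zoom`,
  `scaledEnergy_zoom`, `scaledGradEnergy_zoom`: the zoomed cylinder `Q((t₀, x₀), r)`, `t₀ ≤ 0`, is
  the image of `Q((c²t₀, c x₀), c r)`, again with vertex time `≤ 0`), so the hypothesis supplies
  pressures `P j` with `IsSuitableWeakSolutionInBall 1 0 (u_{c_j}) (P j)` and the uniform bound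
  `K + K < ∞`;
* each zoom is essentially unbounded on every `Q(0, R')`: `‖u_c‖_{L^∞(Q(0,R'))} = c ‖u‖_{L^∞(Q(0,cR'))}`
  (`eLpNorm_top_nsZoom`), and `u`, continuous on the open lower slab and unbounded on every
  `Q(0, ρ)`, is essentially unbounded there (an essentially bounded continuous function on an open
  set is bounded, `exists_forall_norm_le_of_eLpNorm_top_lt_top`);
* pointwise convergence on `Q(0, 1/2) ⊆ {t < 0}`.
-/

noncomputable section

open MeasureTheory Filter Topology Set Metric Function
open scoped NNReal ENNReal

-- Summit = Problem namespace duplication is the tree's layout (CONVENTIONS §1); as in every Theorems file.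
set_option linter.dupNamespace false

namespace Summit.NavierStokesRegularity.NavierStokesRegularity.Theorems.ClockLaw.Birth

open Literature.Analysis Literature.Analysis.FluidPDE

/-- Local notation: `ℝ³`. -/
local notation "E3" => EuclideanSpace ℝ (Fin 3)

/-- **The energy ledger is invariant under the Navier–Stokes zoom about the origin**: if
`A, E ≤ C` on every backward cylinder with vertex time `≤ 0` for `u`, then the same holds for
`u_c = c • stPull (c²) c 0 0 u` (`scaledEnergy_zoom`, `scaledGradEnergy_zoom`: the cylinder
`Q((t₀, x₀), r)` of `u_c` corresponds to `Q((c²t₀, c x₀), c r)` of `u`, vertex time `c²t₀ ≤ 0`).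
[folklore] -/
theorem limitSingular_energyLedger_zoom {C : ℝ} {u : ℝ → E3 → E3} (hu : IsTypeIAncientMild C u)
    (hen : ∀ (x₀ : EuclideanSpace ℝ (Fin 3)) (t₀ r : ℝ), t₀ ≤ 0 → 0 < r →
      (∀ t, t₀ - r ^ 2 < t → t < t₀ → r⁻¹ * ∫ x in Metric.ball x₀ r, ‖u t x‖ ^ 2 ≤ C) ∧
        r⁻¹ * ∫ t in Set.Ioo (t₀ - r ^ 2) t₀, ∫ x in Metric.ball x₀ r, ‖fderiv ℝ (u t) x‖ ^ 2 ≤ C)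
    {c : ℝ} (hc : 0 < c) :
    ∀ (x₀ : EuclideanSpace ℝ (Fin 3)) (t₀ r : ℝ), t₀ ≤ 0 → 0 < r →
      (∀ t, t₀ - r ^ 2 < t → t < t₀ →
        r⁻¹ * ∫ x in Metric.ball x₀ r, ‖(c • stPull (c ^ 2) c 0 0 u) t x‖ ^ 2 ≤ C) ∧
        r⁻¹ * ∫ t in Set.Ioo (t₀ - r ^ 2) t₀, ∫ x in Metric.ball x₀ r,
          ‖fderiv ℝ ((c • stPull (c ^ 2) c 0 0 u) t) x‖ ^ 2 ≤ C := by
  intro y₀ s₀ r hs₀ hr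
  have hc2 : 0 < c ^ 2 := by positivity
  have hcr : 0 < c * r := mul_pos hc hr
  have hs₀' : c ^ 2 * s₀ ≤ 0 := mul_nonpos_of_nonneg_of_nonpos hc2.le hs₀
  have h := hen (0 + c • y₀) (c ^ 2 * s₀) (c * r) hs₀' hcr
  refine ⟨fun s hs1 hs2 => ?_, ?_⟩
  · rw [scaledEnergy_zoom hc 0 y₀ u s hr]
    exact h.1 (c ^ 2 * s) (by nlinarith) (by nlinarith)
  · rw [scaledGradEnergy_zoom hc 0 y₀ u
      (fun t ht => (hu.contDiff_slice ht).differentiable (by simp)) hs₀ hr]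
    exact h.2

/-- **A field continuous on the open lower slab and unbounded near the origin is essentially
unbounded on every `Q(0, ρ)`**: an essentially bounded function continuous on the open cylinder
`Q(0, ρ) ⊆ {t < 0}` is bounded there by its `L^∞` norm
(`exists_forall_norm_le_of_eLpNorm_top_lt_top`), contradicting unboundedness on `Q(0, ρ)`.
[folklore] -/
theorem limitSingular_eLpNorm_top_eq_top {u : ℝ → E3 → E3}
    (hcont : ContinuousOn (uncurry u) (Iio 0 ×ˢ univ))
    (hsing : ∀ r > 0, ∀ M : ℝ, ∃ t ∈ Set.Ioo (-(r ^ 2)) (0 : ℝ),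
      ∃ x ∈ Metric.ball (0 : EuclideanSpace ℝ (Fin 3)) r, M < ‖u t x‖)
    {ρ : ℝ} (hρ : 0 < ρ) :
    eLpNorm (uncurry u) ∞ (volume.restrict (parabolicCylinder ρ (0 : ℝ × E3))) = ∞ := by
  by_contra hfin
  have hsub : parabolicCylinder ρ (0 : ℝ × E3) ⊆ Iio 0 ×ˢ univ := by
    rintro ⟨t, x⟩ hz
    rw [SuitableCompactness.mem_parabolicCylinder_zero] at hz
    exact ⟨hz.1.2, mem_univ _⟩
  have hbd := exists_forall_norm_le_of_eLpNorm_top_lt_top (μ := volume)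
    (isOpen_parabolicCylinder ρ (0 : ℝ × E3)) (hcont.mono hsub) (lt_top_iff_ne_top.2 hfin)
  obtain ⟨t, ht, x, hx, hM⟩ := hsing ρ hρ
    (eLpNorm (uncurry u) ∞ (volume.restrict (parabolicCylinder ρ (0 : ℝ × E3)))).toReal
  have hz : ((t, x) : ℝ × E3) ∈ parabolicCylinder ρ (0 : ℝ × E3) := by
    rw [SuitableCompactness.mem_parabolicCylinder_zero]
    exact ⟨⟨ht.1, ht.2⟩, mem_ball_zero_iff.1 hx⟩
  exact absurd hM (not_lt.2 (hbd (t, x) hz))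

/-- **Every zoom of a field singular at the origin is essentially unbounded on every `Q(0, R')`**:
`‖u_c‖_{L^∞(Q(0,R'))} = c ‖u‖_{L^∞(Q(0, cR'))} = ∞` (`eLpNorm_top_nsZoom` and
`limitSingular_eLpNorm_top_eq_top`). [folklore] -/
theorem limitSingular_eLpNorm_top_zoom_eq_top {u : ℝ → E3 → E3}
    (hcont : ContinuousOn (uncurry u) (Iio 0 ×ˢ univ))
    (hsing : ∀ r > 0, ∀ M : ℝ, ∃ t ∈ Set.Ioo (-(r ^ 2)) (0 : ℝ),
      ∃ x ∈ Metric.ball (0 : EuclideanSpace ℝ (Fin 3)) r, M < ‖u t x‖)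
    {c R' : ℝ} (hc : 0 < c) (hR' : 0 < R') :
    eLpNorm (uncurry (c • stPull (c ^ 2) c 0 0 u)) ∞
      (volume.restrict (parabolicCylinder R' (0 : ℝ × E3))) = ∞ := by
  rw [eLpNorm_top_nsZoom hc 0 0 R' 0, stAffine_sq_zero_zero,
    limitSingular_eLpNorm_top_eq_top hcont hsing (mul_pos hc hR'),
    ENNReal.mul_top (ENNReal.ofReal_pos.2 hc).ne']

/-- **Stub 7 `stub_limitSingular : ClassPressure → LimitSingular` — limits of zooms of a
singular element of the Type-I model class are singular at the origin.** GIVEN the class pressure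
with a uniform bound (for every `C` a `K` such that every Type-I KNSS-mild field with the energy
ledger `A, E ≤ C` is, with some pressure, a suitable weak solution in the unit parabolic ball with
`‖u‖_{L³(Q₁)}, ‖p‖_{L^{3/2}(Q₁)} ≤ K`): if `u` (Type-I KNSS-mild with the ledger) is unbounded on
every `Q(0, r)` and its zooms `c_j • stPull (c_j²) c_j 0 0 u` along positive scales converge
pointwise on `t < 0` to `W`, then `W` is unbounded on every `Q(0, r)`. Persistence of
singularities under the parabolic zoom (Rusin–Šverák 2011; Albritton–Barker 2019, Lemma 2.2 and
Prop. 2.3, through the tree's `unbounded_at_origin_of_zoomIn_limit`), fed with the zooms (in the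
class with the same constant and ledger, `isTypeIAncientMild_zoom`,
`limitSingular_energyLedger_zoom`), the hypothesis' pressures, and the essential unboundedness of
the zooms (`limitSingular_eLpNorm_top_zoom_eq_top`).
[cite: AlbrittonBarker2019, Lemma 2.2 and Prop. 2.3] -/
theorem stub_limitSingular :
    (∀ C : ℝ, ∃ K : NNReal, ∀ u : ℝ → E3 → E3, IsTypeIAncientMild C u →
      (∀ (x₀ : EuclideanSpace ℝ (Fin 3)) (t₀ r : ℝ), t₀ ≤ 0 → 0 < r →
        (∀ t, t₀ - r ^ 2 < t → t < t₀ → r⁻¹ * ∫ x in Metric.ball x₀ r, ‖u t x‖ ^ 2 ≤ C) ∧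
          r⁻¹ * ∫ t in Set.Ioo (t₀ - r ^ 2) t₀, ∫ x in Metric.ball x₀ r, ‖fderiv ℝ (u t) x‖ ^ 2 ≤ C) →
      ∃ p : ℝ → E3 → ℝ, IsSuitableWeakSolutionInBall 1 0 u p ∧
        eLpNorm (Function.uncurry u) 3
            (volume.restrict (parabolicCylinder 1 (0 : ℝ × E3))) ≤ K ∧
        eLpNorm (Function.uncurry p) (3 / 2)
            (volume.restrict (parabolicCylinder 1 (0 : ℝ × E3))) ≤ K) →
    ∀ (C : ℝ) (u : ℝ → E3 → E3), IsTypeIAncientMild C u →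
      (∀ (x₀ : EuclideanSpace ℝ (Fin 3)) (t₀ r : ℝ), t₀ ≤ 0 → 0 < r →
        (∀ t, t₀ - r ^ 2 < t → t < t₀ → r⁻¹ * ∫ x in Metric.ball x₀ r, ‖u t x‖ ^ 2 ≤ C) ∧
          r⁻¹ * ∫ t in Set.Ioo (t₀ - r ^ 2) t₀, ∫ x in Metric.ball x₀ r, ‖fderiv ℝ (u t) x‖ ^ 2 ≤ C) →
      (∀ r > 0, ∀ M : ℝ, ∃ t ∈ Set.Ioo (-(r ^ 2)) (0 : ℝ), ∃ x ∈ Metric.ball (0 : EuclideanSpace ℝ (Fin 3)) r, M < ‖u t x‖) →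
      ∀ c : ℕ → ℝ, (∀ j, 0 < c j) → ∀ W : ℝ → E3 → E3,
        (∀ t < 0, ∀ x, Tendsto
            (fun j => (c j • stPull (c j ^ 2) (c j) 0 0 u) t x) atTop (𝓝 (W t x))) →
        ∀ r > 0, ∀ M : ℝ, ∃ t ∈ Set.Ioo (-(r ^ 2)) (0 : ℝ), ∃ x ∈ Metric.ball (0 : EuclideanSpace ℝ (Fin 3)) r, M < ‖W t x‖ := by
  intro hCP C u hu hen hsing c hc W hW
  obtain ⟨K, hK⟩ := hCP C
  -- each zoom is in the class with the same constant and the same ledger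
  have hclass : ∀ j, IsTypeIAncientMild C (c j • stPull (c j ^ 2) (c j) 0 0 u) := fun j =>
    isTypeIAncientMild_zoom hu (hc j) 0
  have hP' : ∀ j, ∃ p : ℝ → E3 → ℝ,
      IsSuitableWeakSolutionInBall 1 0 (c j • stPull (c j ^ 2) (c j) 0 0 u) p ∧
        eLpNorm (Function.uncurry (c j • stPull (c j ^ 2) (c j) 0 0 u)) 3
            (volume.restrict (parabolicCylinder 1 (0 : ℝ × E3))) ≤ K ∧
        eLpNorm (Function.uncurry p) (3 / 2)
            (volume.restrict (parabolicCylinder 1 (0 : ℝ × E3))) ≤ K := fun j =>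
    hK _ (hclass j) (limitSingular_energyLedger_zoom hu hen (hc j))
  choose P hP using hP'
  refine unbounded_at_origin_of_zoomIn_limit (W := fun j => c j • stPull (c j ^ 2) (c j) 0 0 u)
    (P := P) (fun j => (hP j).1) ?_ (fun j R' hR' => ?_) ?_
  · -- the uniform `L³ × L^{3/2}` bound `≤ K + K < ∞`
    refine lt_of_le_of_lt (iSup_le fun j => add_le_add (hP j).2.1 (hP j).2.2) ?_
    exact ENNReal.add_lt_top.2 ⟨ENNReal.coe_lt_top, ENNReal.coe_lt_top⟩
  · -- each zoom is essentially unbounded on every `Q(0, R')`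
    exact limitSingular_eLpNorm_top_zoom_eq_top hu.continuousOn_uncurry hsing (hc j) hR'.1
  · -- pointwise convergence on `Q(0, 1/2) ⊆ {t < 0}`
    rintro ⟨t, x⟩ hz
    rw [SuitableCompactness.mem_parabolicCylinder_zero] at hz
    exact hW t hz.1.2 x

end Summit.NavierStokesRegularity.NavierStokesRegularity.Theorems.ClockLaw.Birth

end
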